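import Literature.Computability.Cryptography.GraphPathProblemsProofs
import HarnessLib

/-!
# The layered triangle graph: Negative Triangle as one APSP instance

The combinatorial core of a reduction Negative Triangle `≤₃` APSP (Vassilevska Williams–Williams,
J. ACM 65 (2018), Thm. 1.1, direction (3) `≤₃` (1)). In print that direction is obtained by
composing Thm. 4.1 (Negative Triangle `≤₃` matrix product verification, p. 27:14: from the
tripartite input graph `G = (I ∪ J ∪ K, E)` build `A, B, C` and ask whether
`min_k A[i,k] ⊙ B[k,j] < C[i,j]` for some `i, j`) with the classical encoding of a distance product
as a shortest-path computation (cf. the proof of Thm. 5.1, p. 27:22: a tripartite graph with parts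
`I, J, K`, edges only between `I, J` and between `J, K`, weights `A[i,j] + 6M` and `B[j,k] + 6M`, in
which the `i`–`k` distances are the entries of the `(min,+)` product). This file does not transcribe
either step; it gives its own direct rendering of (3) `≤₃` (1) by the classical layered
("three copies of the vertex set") gadget, fused into a single APSP query on a *four*-layer acyclic
digraph:

* `layeredTriangleGraph W` on `Fin (4 * n)` (vertex `Fin.mkDivMod ℓ a` = copy `ℓ ∈ {0,1,2,3}` of
  `a : Fin n`): an arc from copy `ℓ` of `a` to copy `ℓ + 1` of `b` of weight `W a b` whenever `a ≠ b`,
  and no other arcs. It is acyclic, so it has no negative cycle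
  (`hasNoNegativeCycle_layeredTriangleGraph`), and its weights are those of `W`
  (`hasBoundedWeights_layeredTriangleGraph`), so it is an `APSP c` instance whenever `W` is a
  `NegativeTriangle c` instance;
* the distance from copy `0` of `i` to copy `3` of `i` is the minimum weight `W i j + W j k + W k i`
  of a triangle through `i` with `i, j, k` pairwise distinct (`shortestDist_layeredTriangleGraph_le`,
  `exists_triangle_of_shortestDist_layeredTriangleGraph_ne_top`), whence
  **`hasNegativeTriangle_iff_shortestDist_layeredTriangleGraph`**: `W` has a negative triangle iff one
  of these `n` distances is negative.

On the way, general facts about the walk optima `walkDistLE` of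
`Literature.Computability.Cryptography.GraphPathProblems` (from the CLRS §25.1 recurrence
`walkDistLE_succ_apply_holds`): one-step upper bounds (`walkDistLE_succ_le_add`), extraction of a last
edge from a finite optimum (`walkDistLE_succ_ne_top`, `exists_last_edge_of_walkDistLE_ne_top`), and
for digraphs *levelled* by `lev : ι → ℕ` (every arc strictly increases the level): finite optima only
go up (`eq_or_lt_of_walkDistLE_ne_top`), the diagonal is `0` (`walkDistLE_self_of_levels`), hence
**`hasNoNegativeCycle_of_levels`** — an acyclic weighted digraph has no negative cycle.

Everything here is proved.

## References

* V. Vassilevska Williams, R. R. Williams, *Subcubic equivalences between path, matrix, and triangle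
  problems*, J. ACM 65 (2018), Art. 27: Thm. 1.1 (p. 27:3), §4 and Thm. 4.1 (p. 27:13–14, the
  tripartite input convention for Negative Triangle and the reduction to matrix product
  verification), proof of Thm. 5.1 (p. 27:22, the two-layer product gadget with shifted weights).
  doi:10.1145/3186893
* T. H. Cormen, C. E. Leiserson, R. L. Rivest, C. Stein, *Introduction to Algorithms*, 3rd ed.,
  §25.1 (the `(min,+)` recurrence) and §24 (shortest paths in DAGs).
-/

namespace Literature.Computability.Cryptography

open Matrix Tropical

variable {ι : Type*} [Fintype ι] [DecidableEq ι]

/-! ### Consequences of the `(min,+)` recurrence -/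

/-- `walkDistLE W 0` entrywise: `0` on the diagonal, `⊤` off it. [folklore] -/
theorem walkDistLE_zero_apply (W : Matrix ι ι (WithTop ℤ)) (u v : ι) :
    walkDistLE W 0 u v = if u = v then 0 else ⊤ := by
  rw [walkDistLE_zero]
  rfl

/-- One-step upper bound: a cheapest `≤ k`-edge walk to `l` followed by the edge `l → v` is a
`≤ k + 1`-edge walk to `v` (CLRS §25.1). [cite: CLRS2009, §25.1 recurrence (25.2)] -/
theorem walkDistLE_succ_le_add (W : Matrix ι ι (WithTop ℤ)) (k : ℕ) (u l v : ι) :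
    walkDistLE W (k + 1) u v ≤ walkDistLE W k u l + W l v := by
  rw [walkDistLE_succ_apply_holds W k u v]
  exact (min_le_right _ _).trans (Finset.inf_le (Finset.mem_univ l))

/-- If the `≤ k + 1`-edge optimum from `u` to `v` is finite, then either the `≤ k`-edge optimum is
finite, or some `≤ k`-edge optimum to an in-neighbour `l` of `v` is finite (the two branches of the
recurrence; the infimum over the finite vertex set is attained). [folklore] -/
theorem walkDistLE_succ_ne_top (W : Matrix ι ι (WithTop ℤ)) {k : ℕ} {u v : ι}
    (h : walkDistLE W (k + 1) u v ≠ ⊤) :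
    (walkDistLE W (k + 1) u v = walkDistLE W k u v ∧ walkDistLE W k u v ≠ ⊤) ∨
      ∃ l, walkDistLE W (k + 1) u v = walkDistLE W k u l + W l v ∧
        walkDistLE W k u l ≠ ⊤ ∧ W l v ≠ ⊤ := by
  rw [walkDistLE_succ_apply_holds W k u v] at h ⊢
  rcases min_choice (walkDistLE W k u v)
      (Finset.univ.inf fun l => walkDistLE W k u l + W l v) with hmin | hmin
  · rw [hmin] at h ⊢
    exact Or.inl ⟨rfl, h⟩
  · rw [hmin] at h ⊢
    obtain ⟨l, -, hl⟩ := Finset.exists_mem_eq_inf Finset.univ ⟨u, Finset.mem_univ u⟩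
      fun l => walkDistLE W k u l + W l v
    rw [hl] at h ⊢
    exact Or.inr ⟨l, rfl, fun h' => h (by rw [h', WithTop.top_add]),
      fun h' => h (by rw [h', WithTop.add_top])⟩

/-- **Last-edge extraction.** A finite `≤ k`-edge optimum between distinct vertices decomposes as a
finite `≤ k'`-edge optimum to some `l` (`k' < k`) plus a genuine edge `l → v`. [folklore] -/
theorem exists_last_edge_of_walkDistLE_ne_top (W : Matrix ι ι (WithTop ℤ)) :
    ∀ {k : ℕ} {u v : ι}, walkDistLE W k u v ≠ ⊤ → u ≠ v →
      ∃ k' < k, ∃ l, walkDistLE W k u v = walkDistLE W k' u l + W l v ∧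
        walkDistLE W k' u l ≠ ⊤ ∧ W l v ≠ ⊤
  | 0, u, v, h, huv => by
      rw [walkDistLE_zero_apply, if_neg huv] at h
      exact absurd rfl h
  | k + 1, u, v, h, huv => by
      rcases walkDistLE_succ_ne_top W h with ⟨heq, hk⟩ | ⟨l, heq, hl, hlv⟩
      · obtain ⟨k', hk', l, he, hl, hlv⟩ := exists_last_edge_of_walkDistLE_ne_top W hk huv
        exact ⟨k', Nat.lt_succ_of_lt hk', l, heq.trans he, hl, hlv⟩
      · exact ⟨k, Nat.lt_succ_self k, l, heq, hl, hlv⟩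

/-! ### Levelled (acyclic) digraphs have no negative cycle -/

section Levels

variable (W : Matrix ι ι (WithTop ℤ)) (lev : ι → ℕ) (hW : ∀ u v, W u v ≠ ⊤ → lev u < lev v)
include hW

/-- In a digraph levelled by `lev` (every arc strictly increases the level), a finite walk optimum
from `u` to `v` forces `u = v` or `lev u < lev v`. [folklore] -/
theorem eq_or_lt_of_walkDistLE_ne_top :
    ∀ (k : ℕ) (u v : ι), walkDistLE W k u v ≠ ⊤ → u = v ∨ lev u < lev v
  | 0, u, v, h => by
      by_cases huv : u = v
      · exact Or.inl huv
      · rw [walkDistLE_zero_apply, if_neg huv] at h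
        exact absurd rfl h
  | k + 1, u, v, h => by
      rcases walkDistLE_succ_ne_top W h with ⟨-, hk⟩ | ⟨l, -, hl, hlv⟩
      · exact eq_or_lt_of_walkDistLE_ne_top k u v hk
      · right
        rcases eq_or_lt_of_walkDistLE_ne_top k u l hl with rfl | hul
        · exact hW _ _ hlv
        · exact hul.trans (hW _ _ hlv)

/-- In a levelled digraph every closed walk optimum is `0` (the empty walk): no closed walk uses an
arc. (CLRS §24: DAGs have no cycles at all.) [folklore] -/
theorem walkDistLE_self_of_levels : ∀ (k : ℕ) (u : ι), walkDistLE W k u u = 0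
  | 0, u => by rw [walkDistLE_zero_apply, if_pos rfl]
  | k + 1, u => by
      rw [walkDistLE_succ_apply_holds W k u u, walkDistLE_self_of_levels k u]
      refine min_eq_left (Finset.le_inf fun l _ => ?_)
      -- every term `walkDistLE W k u l + W l u` is `⊤`
      by_cases hl : walkDistLE W k u l = ⊤
      · rw [hl, WithTop.top_add]; exact le_top
      by_cases hlu : W l u = ⊤
      · rw [hlu, WithTop.add_top]; exact le_top
      exfalso
      rcases eq_or_lt_of_walkDistLE_ne_top W lev hW k u l hl with rfl | hul
      · exact lt_irrefl _ (hW _ _ hlu)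
      · exact lt_irrefl _ (hul.trans (hW _ _ hlu))

/-- **An acyclic weighted digraph has no negative cycle**: if some `lev : ι → ℕ` strictly increases
along every arc, then `HasNoNegativeCycle W`. (CLRS §24.2, shortest paths in DAGs.)
[cite: CLRS2009, §24.2] -/
theorem hasNoNegativeCycle_of_levels : HasNoNegativeCycle W :=
  fun u => walkDistLE_self_of_levels W lev hW _ u

end Levels

/-! ### The layered triangle graph -/

section Layered

variable {n : ℕ}

/-- **The layered triangle graph** of an integer-weighted complete digraph `W` on `Fin n`: vertex set
`Fin (4 * n)`, vertex `Fin.mkDivMod ℓ a` being copy `ℓ ∈ {0, 1, 2, 3}` of `a : Fin n` (so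
`u.divNat` is the layer and `u.modNat` the original vertex); an arc of weight `W a b` from copy `ℓ` of
`a` to copy `ℓ + 1` of `b` whenever `a ≠ b`, and `⊤` (no arc) otherwise. Walks from copy `0` of `i` to
copy `3` of `i` are exactly the triangles `i → j → k → i` with pairwise distinct vertices. This is
this file's own rendering of the classical layered gadget behind VW–W 2018, Thm. 1.1, (3) `≤₃` (1)
(cf. the tripartite input convention `I ∪ J ∪ K` of §4, p. 27:13–14, and the two-layer product
gadget in the proof of Thm. 5.1, p. 27:22), arranged so that a single directed APSP computation
exposes all triangle weights.
[cite: VassilevskaWilliamsWilliams2018, Thm. 1.1 ((3) ≤₃ (1)); cf. §4 p. 27:13–14 and proof of Thm. 5.1 p. 27:22] -/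
def layeredTriangleGraph (W : Matrix (Fin n) (Fin n) ℤ) :
    Matrix (Fin (4 * n)) (Fin (4 * n)) (WithTop ℤ) :=
  Matrix.of fun u v =>
    if (u.divNat : ℕ) + 1 = v.divNat ∧ u.modNat ≠ v.modNat then ((W u.modNat v.modNat : ℤ) : WithTop ℤ)
    else ⊤

variable (W : Matrix (Fin n) (Fin n) ℤ)

/-- Entries of the layered triangle graph (definition unfolding). [folklore] -/
theorem layeredTriangleGraph_apply (u v : Fin (4 * n)) :
    layeredTriangleGraph W u v =
      if (u.divNat : ℕ) + 1 = v.divNat ∧ u.modNat ≠ v.modNat then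
        ((W u.modNat v.modNat : ℤ) : WithTop ℤ) else ⊤ :=
  rfl

/-- An arc of the layered triangle graph goes one layer up, between copies of distinct vertices, and
carries the corresponding weight of `W`. [folklore] -/
theorem layeredTriangleGraph_ne_top {u v : Fin (4 * n)} (h : layeredTriangleGraph W u v ≠ ⊤) :
    (u.divNat : ℕ) + 1 = v.divNat ∧ u.modNat ≠ v.modNat ∧
      layeredTriangleGraph W u v = ((W u.modNat v.modNat : ℤ) : WithTop ℤ) := by
  rw [layeredTriangleGraph_apply] at h ⊢
  by_cases hc : (u.divNat : ℕ) + 1 = v.divNat ∧ u.modNat ≠ v.modNat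
  · exact ⟨hc.1, hc.2, if_pos hc⟩
  · rw [if_neg hc] at h; exact absurd rfl h

/-- The arc from copy `ℓ` of `a` to copy `ℓ + 1` of `b ≠ a` has weight `W a b`. [folklore] -/
theorem layeredTriangleGraph_mkDivMod (ℓ ℓ' : Fin 4) (hℓ : (ℓ : ℕ) + 1 = ℓ') {a b : Fin n} (hab : a ≠ b) :
    layeredTriangleGraph W (Fin.mkDivMod ℓ a) (Fin.mkDivMod ℓ' b) = ((W a b : ℤ) : WithTop ℤ) := by
  rw [layeredTriangleGraph_apply, if_pos] <;> simp [hℓ, hab]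

/-- The layered triangle graph is levelled by the layer `u.divNat`. [folklore] -/
theorem layeredTriangleGraph_levels (u v : Fin (4 * n)) (h : layeredTriangleGraph W u v ≠ ⊤) :
    (u.divNat : ℕ) < v.divNat := by
  have := (layeredTriangleGraph_ne_top W h).1
  omega

/-- **The layered triangle graph has no negative cycle** (it is acyclic), so it is a legitimate APSP
instance. [folklore] -/
theorem hasNoNegativeCycle_layeredTriangleGraph : HasNoNegativeCycle (layeredTriangleGraph W) :=
  hasNoNegativeCycle_of_levels _ (fun u => (u.divNat : ℕ)) (layeredTriangleGraph_levels W)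

/-- **The layered triangle graph has the weights of `W`**: if `|W a b| ≤ M` for all `a, b` then
`HasBoundedWeights (layeredTriangleGraph W) M`. [folklore] -/
theorem hasBoundedWeights_layeredTriangleGraph {M : ℕ} (hW : ∀ a b, |W a b| ≤ M) :
    HasBoundedWeights (layeredTriangleGraph W) M := by
  intro u v
  rw [layeredTriangleGraph_apply]
  split_ifs
  · exact Or.inr ⟨_, rfl, hW _ _⟩
  · exact Or.inl rfl

/-- The weight bound of a `NegativeTriangle c` instance (`HasBoundedWeights (W.map (↑)) M`) in the
form `∀ a b, |W a b| ≤ M`. [folklore] -/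
theorem forall_abs_le_of_hasBoundedWeights_map {M : ℕ}
    (hW : HasBoundedWeights (W.map ((↑) : ℤ → WithTop ℤ)) M) (a b : Fin n) : |W a b| ≤ M := by
  rcases hW a b with h | ⟨z, hz, hzM⟩
  · rw [Matrix.map_apply] at h
    exact absurd h WithTop.coe_ne_top
  · rw [Matrix.map_apply] at hz
    have : W a b = z := WithTop.coe_injective hz
    rwa [this]

/-- **Upper bound**: the distance from copy `0` of `i` to copy `3` of `i` in the layered triangle
graph is at most the weight of any triangle `i → j → k → i` with pairwise distinct vertices (the walk
through copies `1` of `j` and `2` of `k`). [folklore] -/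
theorem shortestDist_layeredTriangleGraph_le {i j k : Fin n} (hij : i ≠ j) (hjk : j ≠ k) (hki : k ≠ i) :
    shortestDist (layeredTriangleGraph W) (Fin.mkDivMod 0 i) (Fin.mkDivMod 3 i) ≤
      ((W i j + W j k + W k i : ℤ) : WithTop ℤ) := by
  set G := layeredTriangleGraph W with hG
  have hn : 3 ≤ Fintype.card (Fin (4 * n)) := by
    rw [Fintype.card_fin]
    have := i.pos
    omega
  have h1 : walkDistLE G 1 (Fin.mkDivMod 0 i) (Fin.mkDivMod 1 j) ≤ ((W i j : ℤ) : WithTop ℤ) := by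
    refine (walkDistLE_succ_le_add G 0 _ (Fin.mkDivMod 0 i) _).trans ?_
    rw [walkDistLE_zero_apply, if_pos rfl, zero_add, hG, layeredTriangleGraph_mkDivMod W 0 1 rfl hij]
  have h2 : walkDistLE G 2 (Fin.mkDivMod 0 i) (Fin.mkDivMod 2 k) ≤ ((W i j + W j k : ℤ) : WithTop ℤ) := by
    refine (walkDistLE_succ_le_add G 1 _ (Fin.mkDivMod 1 j) _).trans ?_
    rw [hG, layeredTriangleGraph_mkDivMod W 1 2 rfl hjk, WithTop.coe_add]
    exact add_le_add h1 le_rfl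
  have h3 : walkDistLE G 3 (Fin.mkDivMod 0 i) (Fin.mkDivMod 3 i) ≤
      ((W i j + W j k + W k i : ℤ) : WithTop ℤ) := by
    refine (walkDistLE_succ_le_add G 2 _ (Fin.mkDivMod 2 k) _).trans ?_
    rw [hG, layeredTriangleGraph_mkDivMod W 2 3 rfl hki, WithTop.coe_add]
    exact add_le_add h2 le_rfl
  exact (shortestDist_le_of_le_holds G hn _ _).trans h3

/-- **Extraction**: if the distance from copy `0` of `i` to copy `3` of `i` is finite, it is the weight
of a triangle `i → j → k → i` with pairwise distinct vertices (peel off the last three arcs; the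
remaining finite optimum stays in layer `0`, hence at `i` with value `0`). [folklore] -/
theorem exists_triangle_of_shortestDist_layeredTriangleGraph_ne_top (i : Fin n)
    (h : shortestDist (layeredTriangleGraph W) (Fin.mkDivMod 0 i) (Fin.mkDivMod 3 i) ≠ ⊤) :
    ∃ j k, i ≠ j ∧ j ≠ k ∧ k ≠ i ∧
      shortestDist (layeredTriangleGraph W) (Fin.mkDivMod 0 i) (Fin.mkDivMod 3 i) =
        ((W i j + W j k + W k i : ℤ) : WithTop ℤ) := by
  set s := Fin.mkDivMod (0 : Fin 4) i with hs
  set t := Fin.mkDivMod (3 : Fin 4) i with ht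
  have hlev := layeredTriangleGraph_levels W
  have hsd : (s.divNat : ℕ) = 0 := by simp [hs]
  have htd : (t.divNat : ℕ) = 3 := by simp [ht]
  have hsm : s.modNat = i := by simp [hs]
  have htm : t.modNat = i := by simp [ht]
  have hst : s ≠ t := fun h' => by
    have h'' := congrArg (fun u : Fin (4 * n) => (u.divNat : ℕ)) h'
    simp only [hsd, htd] at h''
    omega
  -- last arc: `l₂ → t`
  obtain ⟨k₂, -, l₂, he₂, hf₂, ha₂⟩ :=
    exists_last_edge_of_walkDistLE_ne_top (layeredTriangleGraph W) h hst
  obtain ⟨hl₂, hm₂, hw₂⟩ := layeredTriangleGraph_ne_top W ha₂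
  rw [htd] at hl₂
  have hsl₂ : s ≠ l₂ := fun h' => by
    have h'' := congrArg (fun u : Fin (4 * n) => (u.divNat : ℕ)) h'
    simp only [hsd] at h''
    omega
  -- middle arc: `l₁ → l₂`
  obtain ⟨k₁, -, l₁, he₁, hf₁, ha₁⟩ :=
    exists_last_edge_of_walkDistLE_ne_top (layeredTriangleGraph W) hf₂ hsl₂
  obtain ⟨hl₁, hm₁, hw₁⟩ := layeredTriangleGraph_ne_top W ha₁
  have hsl₁ : s ≠ l₁ := fun h' => by
    have h'' := congrArg (fun u : Fin (4 * n) => (u.divNat : ℕ)) h'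
    simp only [hsd] at h''
    omega
  -- first arc: `l₀ → l₁`
  obtain ⟨k₀, -, l₀, he₀, hf₀, ha₀⟩ :=
    exists_last_edge_of_walkDistLE_ne_top (layeredTriangleGraph W) hf₁ hsl₁
  obtain ⟨hl₀, hm₀, hw₀⟩ := layeredTriangleGraph_ne_top W ha₀
  -- the remaining finite optimum stays in layer 0, hence `l₀ = s`
  have hl₀s : l₀ = s := by
    rcases eq_or_lt_of_walkDistLE_ne_top (layeredTriangleGraph W) (fun u => (u.divNat : ℕ)) hlev k₀ s l₀
        hf₀ with h' | h'
    · exact h'.symm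
    · exfalso
      simp only [hsd] at h'
      omega
  subst hl₀s
  have h0 : walkDistLE (layeredTriangleGraph W) k₀ s s = 0 :=
    walkDistLE_self_of_levels (layeredTriangleGraph W) (fun u => (u.divNat : ℕ)) hlev k₀ s
  -- read off the triangle
  refine ⟨l₁.modNat, l₂.modNat, ?_, hm₁, ?_, ?_⟩
  · rw [← hsm]; exact hm₀
  · rw [← htm]; exact hm₂
  · change walkDistLE (layeredTriangleGraph W) _ s t = _ at he₂
    change walkDistLE (layeredTriangleGraph W) _ s t = _
    rw [he₂, he₁, he₀, h0, zero_add, hw₀, hw₁, hw₂, hsm, htm]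
    push_cast
    ring

/-- **Negative Triangle as one APSP instance.** `W` has a negative triangle iff, in the layered
triangle graph, some vertex `i` has negative distance from its copy `0` to its copy `3`. This is what
the word-RAM reduction Negative Triangle `≤₃` APSP checks on the oracle's answer (the layered
rendering of VW–W 2018, Thm. 1.1, (3) `≤₃` (1); in print via Thm. 4.1, p. 27:14).
[cite: VassilevskaWilliamsWilliams2018, Thm. 1.1 ((3) ≤₃ (1)); cf. Thm. 4.1 (p. 27:14)] -/
theorem hasNegativeTriangle_iff_shortestDist_layeredTriangleGraph :
    HasNegativeTriangle W ↔
      ∃ i : Fin n, shortestDist (layeredTriangleGraph W) (Fin.mkDivMod 0 i) (Fin.mkDivMod 3 i) < 0 := by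
  constructor
  · rintro ⟨i, j, k, hij, hjk, hik, hlt⟩
    refine ⟨i, lt_of_le_of_lt (shortestDist_layeredTriangleGraph_le W hij hjk (Ne.symm hik)) ?_⟩
    exact_mod_cast hlt
  · rintro ⟨i, hi⟩
    have hne : shortestDist (layeredTriangleGraph W) (Fin.mkDivMod 0 i) (Fin.mkDivMod 3 i) ≠ ⊤ :=
      fun h => by rw [h] at hi; exact not_top_lt hi
    obtain ⟨j, k, hij, hjk, hki, hs⟩ :=
      exists_triangle_of_shortestDist_layeredTriangleGraph_ne_top W i hne
    rw [hs] at hi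
    exact ⟨i, j, k, hij, hjk, Ne.symm hki, by exact_mod_cast hi⟩

/-- The same criterion on a finite negative value: some distance is a negative integer. [folklore] -/
theorem hasNegativeTriangle_iff_exists_shortestDist_layeredTriangleGraph_eq_neg :
    HasNegativeTriangle W ↔ ∃ i : Fin n, ∃ z : ℤ, z < 0 ∧
      shortestDist (layeredTriangleGraph W) (Fin.mkDivMod 0 i) (Fin.mkDivMod 3 i) = z := by
  rw [hasNegativeTriangle_iff_shortestDist_layeredTriangleGraph]
  refine exists_congr fun i => ⟨fun hi => ?_, ?_⟩
  · have hne : shortestDist (layeredTriangleGraph W) (Fin.mkDivMod 0 i) (Fin.mkDivMod 3 i) ≠ ⊤ :=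
      fun h => by rw [h] at hi; exact not_top_lt hi
    obtain ⟨z, hz⟩ := WithTop.ne_top_iff_exists.1 hne
    refine ⟨z, ?_, hz.symm⟩
    rw [← hz] at hi
    exact_mod_cast hi
  · rintro ⟨z, hz, hs⟩
    rw [hs]
    exact_mod_cast hz

end Layered

end Literature.Computability.Cryptography
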